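import Summits.QuantumFields.BalabanUV.Beta.EriceRemainderEnclosureHistoryAutonomyComparisonAgeCompositionOldBlockLetters

/-!
# EriceRemainderEnclosureHistoryAutonomyComparisonAgeCompositionOldBlockCapWide — (E100e) route (N), first order: THE ARGMAX CERTIFICATE WITH THE VALUE
# AND THE EXPONENT AS PARAMETERS, AND THE DOUBLE-OCTAVE CAP.  (E100a)∕(E100b) fix `V = 5∕8` and the potential `k^6·u^{14}` (exponent `1∕7`), the right
# balance for ONE octave.  Wider blocks want a larger exponent and pay a larger `V` (`HOME/b2b-balaban-beta-d4-p2/g88/numerics/alpha_span2.py`: span 3 →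
# `V ≈ 0.647` at `1∕7`, span 4 → `V ≈ 0.671` at `1∕6`).  This file re-proves the three per-age box lemmas with `V`, and the potential `k^P·u_k^Q`, as
# PARAMETERS (**`young_in_old_window_of_box'`**, **`old_in_young_window_of_box'`**, **`own_window_le'`**), the argmax step once for all
# (**`block_load_le_of_argmax`**: if every ordered pair of members satisfies the per-age inequality under the argmax hypothesis, the block carries `≤ V`), and
# types the DOUBLE OCTAVE: **`old_block_load_le_span4`** — ANY finite set of ages inside `[lo, hi]`, `56 ≤ lo`, `hi ≤ 4·lo`, carries `Σ x_k(m) ≤ 11∕16` at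
# every pin (potential `k^5·u^{12}`, 16 K-boxes + 3 J-boxes, `block_cert_wide.py` → `block_cert_wide.json`, exact):
# K-boxes [F1,F2]: (ca, cb, sh) — [1, 547/500]: (9731/10000, 407/500, 5191/5000); [547/500, 1209/1000]: (2369/2500, 8261/10000, 10823/10000);
#   [1209/1000, 337/250]: (4597/5000, 8389/10000, 453/400); [337/250, 189/125]: (8891/10000, 213/250, 297/250);
#   [189/125, 17/10]: (4289/5000, 8649/10000, 499/400); [17/10, 1911/1000]: (8263/10000, 2193/2500, 6549/5000);
#   [1911/1000, 2141/1000]: (7957/10000, 4443/5000, 13733/10000); [2141/1000, 298/125]: (7667/10000, 2247/2500, 7181/5000);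
#   [298/125, 1317/500]: (37/50, 9077/10000, 3743/2500); [1317/500, 721/250]: (7159/10000, 4577/5000, 3887/2500);
#   [721/250, 391/125]: (1389/2000, 9219/10000, 16083/10000); [391/125, 3361/1000]: (3379/5000, 9273/10000, 4143/2500);
#   [3361/1000, 3579/1000]: (1649/2500, 9319/10000, 4253/2500); [3579/1000, 3779/1000]: (6457/10000, 2339/2500, 17401/10000);
#   [3779/1000, 99/25]: (3169/5000, 9387/10000, 1109/625); [99/25, 4]: (6313/10000, 9413/10000, 8909/5000)
# J-boxes [F1,F2]: (cb, sl) — [1, 393/200]: (407/500, 1787/2000); [393/200, 423/125]: (557/625, 8161/10000); [423/125, 4]: (9323/10000, 7937/10000)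
# Closure of the ×R chain with `s = 11∕16` at `κ = 1∕5`: `0.2 + 4·(11∕16)·1.2 = 3.5 ≤ R₀·(1 − 0.825)·0.2` iff `R₀ ≥ 100` — double octaves are levels of a
# ×100 chain (the sequel (E100f)).

Cell `pub-balaban`, β-function sub-cell, BINDER row D4 «RemainderConst leaves for Bałaban's split» (`HOME/BINDER-OWNERS.md`; owner lineage `b2b-balaban-beta-an4`;
this file by co-owner #2 lineage `b2b-balaban-beta-d4-p2`, generation 88), β-FLOW TEAM duty (1), FREEZE (0) honoured (def-free; nothing restated).

HONEST FRAMING (page 1, verbatim and binding).  *"Discharging BetaPertH makes Bałaban's UV stability UNCONDITIONAL — a real constructive-QFT result; it is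
NOT the continuum limit and NOT the Clay problem."*  THIS FILE DISCHARGES NOTHING OF THE KIND.  Elementary real algebra ∕ real analysis about ABSTRACT
functionals on a box ]0,γ]^ℕ with displayed floors, profiles and signs, and the FIRST-ORDER renewal objects of route (N) built from them — hypotheses of a
census, not facts; the form, signs, ages and moments of Bałaban's (1.22) limit functional are NOT PRINTED ([I] p. 298; GAPS G-t4-U2-1∕-2) and NOT asserted.
Row D4 class UNCHANGED (critical-path width 0; instance 0∕1; D4 DISCHARGE NO DATE).  HONEST DEPENDENCY: continuum YM on T⁴ ⇐ BetaPertH ∧ nine spine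
estimates (0/9 proved); BetaPertH ⇐ (D1) ∧ (D4) ∧ CAP+tail; G-an2-4 gates asym, D1 and NE2/3/4.

THE POINT (README `HOME/b2b-balaban-beta-d4-p2/g88/README.md` §4).  With exponent `α = R∕(P+R)` the argmax of `k^P·u^{2(P+R)}` gives, for a younger age,
`σ^{2(P+R)} ≤ F^P`, and for an older age `ρ^{P+R} ≥ F^{-R}`; the box side conditions become `F₂^P ≤ sh^{2(P+R)}` and `sl^{P+R}·F₂^R ≤ 1`, everything
else as in (E100a).  Uses (E100a) `young_reads_ge`, `old_reads_ge`, `block_window_reads_le`, (E94b) `window_sum_ge`, (E79) `strictAnti_of_memFlow`,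
Mathlib `Finset.exists_max_image` BY NAME.  NOT CLAIMED: spans `> 4`; `V < 11∕16` at span 4; anything printed — NOT B12 Thm 2, NOT BetaPertH, NOT
continuum, NOT Clay.

WHAT IS PROVED ([folklore]; 0 `def`, 0 sorry).  §1 **`young_in_old_window_of_box'`**, **`old_in_young_window_of_box'`**, **`own_window_le'`**.  §2
**`block_load_le_of_argmax`**.  §3 **`young_in_old_window_span4`**, **`old_in_young_window_span4`**, **`old_block_load_le_span4`**.
-/
noncomputable section
open Finset

namespace Summit.QuantumFields.BalabanUV.Beta.EriceRemainderEnclosureHistoryAutonomyComparisonAgeCompositionOldBlockCapWide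

open Literature.MathematicalPhysics.QuantumFieldTheory.Balaban1983to89
open Literature.MathematicalPhysics.QuantumFieldTheory.Balaban1983to89.T4BetaStationary
open Literature.MathematicalPhysics.QuantumFieldTheory.Balaban1983to89.T4BetaFlowWellPosed
open Summit.QuantumFields.BalabanUV.Beta.EriceRemainderEnclosureHistoryAutonomyOrder (strictAnti_of_memFlow)
open Summit.QuantumFields.BalabanUV.Beta.EriceRemainderEnclosureHistoryAutonomyComparisonAgeCompositionYoungPairMoment (window_sum_ge)
open Summit.QuantumFields.BalabanUV.Beta.EriceRemainderEnclosureHistoryAutonomyComparisonAgeCompositionOldBlockLetters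
  (block_window_reads_le young_reads_ge old_reads_ge)

variable {B : (ℕ → ℝ) → ℝ} {γ b gIR : ℝ} {L : ℕ → ℝ} {K : ℕ} {h : ℕ → ℝ}

/-! ## §1 The per-age box lemmas with `V` and the potential `k^P·u^{2(P+R)}` as parameters -/

/-- **A YOUNGER AGE IN THE ARGMAX WINDOW — parametric box (K side).**  As (E100a) `young_in_old_window_of_box` with the value `V > 0` and the potential
`k^P·h_{m+k}^{2(P+R)}` free: ages `56 ≤ i < n`, `F₁·i ≤ n ≤ F₂·i`, `i^P·h_{m+i}^{2(P+R)} ≤ n^P·h_{m+n}^{2(P+R)}`, box constants with `F₂^P ≤ sh^{2(P+R)}`,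
`2V·c_a(F₁−1) ≤ 3` and the closure `sh³ ≤ 2V(c_a(F₁−1)sh + c_b)` ⟹ `i·h_{m+i}³∕2 ≤ V·h_{m+n}²·Σ_{q<n} h_{m+q+1+i}`. [folklore] -/
theorem young_in_old_window_of_box' (hmono : ∀ u v : ℕ → ℝ, SeqBox γ u → SeqBox γ v → (∀ j, u j ≤ v j) → B u ≤ B v) (hb : 0 < b)
    (hlo : ∀ u, SeqBox γ u → b ≤ B u) (hh : SeqBox γ h) (hf : MemFlow B gIR h) {i n : ℕ} (h56 : 56 ≤ i) (hin : i < n) (m : ℕ)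
    {V : ℝ} {P R : ℕ} (hV : 0 < V) (hQ : 0 < P + R) {F₁ F₂ ca cb sh : ℝ} (hn1 : F₁ * i ≤ n) (hn2 : (n : ℝ) ≤ F₂ * i)
    (harg : (i : ℝ) ^ P * h (m + i) ^ (2 * (P + R)) ≤ (n : ℝ) ^ P * h (m + n) ^ (2 * (P + R)))
    (hbox : 1 ≤ F₁ ∧ 0 ≤ ca ∧ 0 ≤ cb ∧ 0 < sh ∧ ca ^ 2 * ((1 + F₂) * 56 + 1) ≤ 112 ∧ ca ^ 2 * (1 + F₂) ≤ 2
      ∧ cb ^ 2 * (112 * F₁ + 57) ≤ 112 * F₁ ∧ cb ^ 2 ≤ 1 ∧ F₂ ^ P ≤ sh ^ (2 * (P + R)) ∧ 2 * V * (ca * (F₁ - 1)) ≤ 3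
      ∧ sh ^ 3 ≤ 2 * V * (ca * (F₁ - 1) * sh + cb)) :
    (i : ℝ) * h (m + i) ^ 3 / 2 ≤ V * (h (m + n) ^ 2 * ∑ q ∈ range n, h (m + q + 1 + i)) := by
  obtain ⟨hF1, hca0, hcb0, hsh, hc1a, hc1b, hc2a, hc2b, hc3, hc4, hc5⟩ := hbox
  have hpos : ∀ n, 0 < h n := fun n => (hh n).1
  have hanti := (strictAnti_of_memFlow hb hlo hh hf).antitone
  have hir : (56 : ℝ) ≤ i := by exact_mod_cast h56
  have hinr : (i : ℝ) + 1 ≤ n := by exact_mod_cast hin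
  have hipos : (0 : ℝ) < i := by linarith
  have hF2 : 1 ≤ F₂ := le_of_mul_le_mul_right (by linarith : (1 : ℝ) * i ≤ F₂ * i) hipos
  have hreads := young_reads_ge hmono hb hlo hh hf (by omega) hin (ca := ca) (cb := cb) ?_ ?_ m
  rotate_left
  · have h1 : ca ^ 2 * ((i : ℝ) + n + 1) ≤ ca ^ 2 * ((1 + F₂) * i + 1) := mul_le_mul_of_nonneg_left (by linarith) (sq_nonneg ca)
    have h2 := mul_le_mul_of_nonneg_left hir (sub_nonneg.2 hc1b)
    nlinarith
  · have hE : 0 ≤ 2 * F₁ - 2 * cb ^ 2 * F₁ - cb ^ 2 := by nlinarith [sq_nonneg cb]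
    have h1 := mul_le_mul_of_nonneg_left hn1 (by nlinarith : (0 : ℝ) ≤ 2 - 2 * cb ^ 2)
    have h2 := mul_le_mul_of_nonneg_left hir hE
    nlinarith
  set u := h (m + i) with hu_def
  set w := h (m + n) with hw_def
  set Rd := ∑ q ∈ range n, h (m + q + 1 + i) with hRd_def
  have hu : 0 < u := hpos _
  have hw : 0 < w := hpos _
  have hwu : w ≤ u := hanti (by omega)
  -- σ ≤ sh from the argmax inequality
  have hush : u ≤ sh * w := by
    have h1 : (n : ℝ) ^ P ≤ (F₂ * i) ^ P := pow_le_pow_left₀ (by positivity) hn2 P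
    have h3 : (i : ℝ) ^ P * u ^ (2 * (P + R)) ≤ (i : ℝ) ^ P * (sh * w) ^ (2 * (P + R)) := by
      calc (i : ℝ) ^ P * u ^ (2 * (P + R)) ≤ (n : ℝ) ^ P * w ^ (2 * (P + R)) := harg
        _ ≤ (F₂ * i) ^ P * w ^ (2 * (P + R)) := mul_le_mul_of_nonneg_right h1 (by positivity)
        _ = F₂ ^ P * ((i : ℝ) ^ P * w ^ (2 * (P + R))) := by ring
        _ ≤ sh ^ (2 * (P + R)) * ((i : ℝ) ^ P * w ^ (2 * (P + R))) := mul_le_mul_of_nonneg_right hc3 (by positivity)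
        _ = (i : ℝ) ^ P * (sh * w) ^ (2 * (P + R)) := by ring
    exact le_of_pow_le_pow_left₀ (by omega) (by positivity) (le_of_mul_le_mul_left h3 (by positivity))
  have hsh1 : 1 ≤ sh := by
    by_contra hlt
    push Not at hlt
    have : sh * w < 1 * w := mul_lt_mul_of_pos_right hlt hw
    linarith
  -- the cube under its chord
  have hkey : u ^ 3 ≤ 2 * V * (ca * (F₁ - 1)) * u * w ^ 2 + 2 * V * cb * w ^ 3 := by
    have hq : 0 ≤ u ^ 2 + u * (sh * w) + (sh * w) ^ 2 - 2 * V * (ca * (F₁ - 1)) * w ^ 2 := by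
      have h1 : w ^ 2 ≤ u ^ 2 := pow_le_pow_left₀ hw.le hwu 2
      have h2 : w * w ≤ u * (sh * w) := mul_le_mul hwu (hwu.trans hush) hw.le hu.le
      have h3 : w ^ 2 ≤ (sh * w) ^ 2 := pow_le_pow_left₀ hw.le (hwu.trans hush) 2
      have h4 := mul_le_mul_of_nonneg_right hc4 (sq_nonneg w)
      nlinarith
    have hprod := mul_nonneg (sub_nonneg.2 hush) hq
    have hclo : w ^ 3 * sh ^ 3 ≤ w ^ 3 * (2 * V * (ca * (F₁ - 1) * sh + cb)) := mul_le_mul_of_nonneg_left hc5 (by positivity)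
    have e : u ^ 3 - (2 * V * (ca * (F₁ - 1)) * u * w ^ 2 + 2 * V * cb * w ^ 3)
        = -((sh * w - u) * (u ^ 2 + u * (sh * w) + (sh * w) ^ 2 - 2 * V * (ca * (F₁ - 1)) * w ^ 2))
          + (w ^ 3 * sh ^ 3 - w ^ 3 * (2 * V * (ca * (F₁ - 1) * sh + cb))) := by ring
    linarith
  have hG : (F₁ - 1) * i ≤ (n : ℝ) - i := by linarith
  have hA : 2 * V * (ca * (F₁ - 1)) * u * w ^ 2 * i ≤ 2 * V * ca * ((n : ℝ) - i) * u * w ^ 2 := by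
    have h1 := mul_le_mul_of_nonneg_left hG (by positivity : (0 : ℝ) ≤ 2 * V * ca * u * w ^ 2)
    have e1 : 2 * V * (ca * (F₁ - 1)) * u * w ^ 2 * i = 2 * V * ca * u * w ^ 2 * ((F₁ - 1) * i) := by ring
    have e2 : 2 * V * ca * ((n : ℝ) - i) * u * w ^ 2 = 2 * V * ca * u * w ^ 2 * ((n : ℝ) - i) := by ring
    linarith
  have hB : (i : ℝ) * u ^ 3 ≤ 2 * V * (w ^ 2 * (ca * ((n : ℝ) - i) * u + cb * i * w)) := by
    have h1 := mul_le_mul_of_nonneg_right hkey hipos.le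
    have e1 : (2 * V * (ca * (F₁ - 1)) * u * w ^ 2 + 2 * V * cb * w ^ 3) * i
        = 2 * V * (ca * (F₁ - 1)) * u * w ^ 2 * i + 2 * V * cb * w ^ 3 * i := by ring
    have e2 : 2 * V * (w ^ 2 * (ca * ((n : ℝ) - i) * u + cb * i * w))
        = 2 * V * ca * ((n : ℝ) - i) * u * w ^ 2 + 2 * V * cb * w ^ 3 * i := by ring
    linarith
  have hC := mul_le_mul_of_nonneg_left hreads (by positivity : (0 : ℝ) ≤ 2 * V * w ^ 2)
  have e3 : 2 * V * w ^ 2 * (ca * ((n : ℝ) - i) * u + cb * i * w) = 2 * V * (w ^ 2 * (ca * ((n : ℝ) - i) * u + cb * i * w)) := by ring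
  have e4 : 2 * V * w ^ 2 * Rd = 2 * (V * (w ^ 2 * Rd)) := by ring
  linarith

/-- **AN OLDER AGE IN THE ARGMAX WINDOW — parametric box (J side).**  As (E100a) `old_in_young_window_of_box` with `V > 0` and the potential free: ages
`56 ≤ n < i`, `F₁·n ≤ i ≤ F₂·n`, `i^P·h_{m+i}^{2(P+R)} ≤ n^P·h_{m+n}^{2(P+R)}`, box constants with `sl^{P+R}·F₂^R ≤ 1` and the closure `1 ≤ 2V·c_b·sl` ⟹
`i·h_{m+i}³∕2 ≤ V·h_{m+n}²·Σ_{q<n} h_{m+q+1+i}`. [folklore] -/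
theorem old_in_young_window_of_box' (hmono : ∀ u v : ℕ → ℝ, SeqBox γ u → SeqBox γ v → (∀ j, u j ≤ v j) → B u ≤ B v) (hb : 0 < b)
    (hlo : ∀ u, SeqBox γ u → b ≤ B u) (hh : SeqBox γ h) (hf : MemFlow B gIR h) {i n : ℕ} (h56 : 56 ≤ n) (hni : n < i) (m : ℕ)
    {V : ℝ} {P R : ℕ} (hV : 0 < V) (hQ : 0 < P + R) {F₁ F₂ cb sl : ℝ} (hi1 : F₁ * n ≤ i) (hi2 : (i : ℝ) ≤ F₂ * n)
    (harg : (i : ℝ) ^ P * h (m + i) ^ (2 * (P + R)) ≤ (n : ℝ) ^ P * h (m + n) ^ (2 * (P + R)))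
    (hbox : 1 ≤ F₁ ∧ 0 ≤ cb ∧ 0 < sl ∧ cb ^ 2 * (112 * F₁ + 57) ≤ 112 * F₁ ∧ cb ^ 2 ≤ 1 ∧ sl ^ (P + R) * F₂ ^ R ≤ 1 ∧ 1 ≤ 2 * V * cb * sl) :
    (i : ℝ) * h (m + i) ^ 3 / 2 ≤ V * (h (m + n) ^ 2 * ∑ q ∈ range n, h (m + q + 1 + i)) := by
  obtain ⟨hF1, hcb0, hsl, hc2a, hc2b, hc3, hc4⟩ := hbox
  have hpos : ∀ n, 0 < h n := fun n => (hh n).1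
  have hnr : (56 : ℝ) ≤ n := by exact_mod_cast h56
  have hnir : (n : ℝ) + 1 ≤ i := by exact_mod_cast hni
  have hnpos : (0 : ℝ) < n := by linarith
  have hF2 : 0 ≤ F₂ := by nlinarith
  set u := h (m + i) with hu_def
  set w := h (m + n) with hw_def
  set Rd := ∑ q ∈ range n, h (m + q + 1 + i) with hRd_def
  have hu : 0 < u := hpos _
  have hw : 0 < w := hpos _
  have hcb : cb ^ 2 * (2 * (i : ℝ) + n + 1) ≤ 2 * i := by
    have hE : 0 ≤ 2 * F₁ - 2 * cb ^ 2 * F₁ - cb ^ 2 := by nlinarith [sq_nonneg cb]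
    have h1 := mul_le_mul_of_nonneg_left hi1 (by nlinarith : (0 : ℝ) ≤ 2 - 2 * cb ^ 2)
    have h2 := mul_le_mul_of_nonneg_left hnr hE
    nlinarith
  have hreads := old_reads_ge hmono hb hlo hh hf (by omega : 1 ≤ i) n hcb m
  -- ρ ≥ sl from the argmax inequality: (sl·i·u²)^{P+R} ≤ (n·w²)^{P+R}
  have hrho : sl * i * u ^ 2 ≤ n * w ^ 2 := by
    have h0 : (i : ℝ) ^ R ≤ F₂ ^ R * (n : ℝ) ^ R := by rw [← mul_pow]; exact pow_le_pow_left₀ (by positivity) hi2 R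
    have h1 : sl ^ (P + R) * (i : ℝ) ^ R ≤ (n : ℝ) ^ R := by
      have := mul_le_mul_of_nonneg_left h0 (by positivity : (0 : ℝ) ≤ sl ^ (P + R))
      have := mul_le_mul_of_nonneg_right hc3 (by positivity : (0 : ℝ) ≤ (n : ℝ) ^ R)
      nlinarith
    have h2 : (sl * i * u ^ 2) ^ (P + R) ≤ ((n : ℝ) * w ^ 2) ^ (P + R) := by
      have h3 := mul_le_mul_of_nonneg_right h1 (by positivity : (0 : ℝ) ≤ (i : ℝ) ^ P * u ^ (2 * (P + R)))
      have h4 := mul_le_mul_of_nonneg_left harg (by positivity : (0 : ℝ) ≤ (n : ℝ) ^ R)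
      calc (sl * i * u ^ 2) ^ (P + R) = sl ^ (P + R) * (i : ℝ) ^ R * ((i : ℝ) ^ P * u ^ (2 * (P + R))) := by
            rw [mul_pow, mul_pow, ← pow_mul, pow_add (i : ℝ) P R]; ring
        _ ≤ (n : ℝ) ^ R * ((n : ℝ) ^ P * w ^ (2 * (P + R))) := by linarith
        _ = ((n : ℝ) * w ^ 2) ^ (P + R) := by rw [mul_pow, ← pow_mul, pow_add (n : ℝ) P R]; ring
    exact le_of_pow_le_pow_left₀ (by omega) (by positivity) h2
  have hB : (i : ℝ) * u ^ 2 ≤ 2 * V * cb * (n * w ^ 2) := by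
    have := mul_le_mul_of_nonneg_right hc4 (by positivity : (0 : ℝ) ≤ (i : ℝ) * u ^ 2)
    have := mul_le_mul_of_nonneg_left hrho (by positivity : (0 : ℝ) ≤ 2 * V * cb)
    nlinarith
  have hC := mul_le_mul_of_nonneg_left hreads (by positivity : (0 : ℝ) ≤ V * w ^ 2)
  have hD := mul_le_mul_of_nonneg_right hB hu.le
  have e1 : V * w ^ 2 * Rd = V * (w ^ 2 * Rd) := by ring
  nlinarith

/-- **THE ARGMAX WINDOW'S OWN AGE — parametric value.**  An age `n ≥ 56` and `V` with `2V·0.8104 ≥ 1`: `n·h_{m+n}³∕2 ≤ V·h_{m+n}²·Σ_{q<n} h_{m+q+1+n}`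
((E94b) `window_sum_ge`, `c_K = 0.8104`). [folklore] -/
theorem own_window_le' (hmono : ∀ u v : ℕ → ℝ, SeqBox γ u → SeqBox γ v → (∀ j, u j ≤ v j) → B u ≤ B v) (hb : 0 < b)
    (hlo : ∀ u, SeqBox γ u → b ≤ B u) (hh : SeqBox γ h) (hf : MemFlow B gIR h) {n : ℕ} (h56 : 56 ≤ n) (m : ℕ) {V : ℝ}
    (hV : 1 ≤ 2 * V * (1013 / 1250)) :
    (n : ℝ) * h (m + n) ^ 3 / 2 ≤ V * (h (m + n) ^ 2 * ∑ q ∈ range n, h (m + q + 1 + n)) := by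
  have hpos : ∀ n, 0 < h n := fun n => (hh n).1
  have hnr : (56 : ℝ) ≤ n := by exact_mod_cast h56
  have hw := hpos (m + n)
  have hV0 : 0 ≤ V := by nlinarith
  have hcK : ((1013 : ℝ) / 1250) ^ 2 * (3 * (n : ℝ) + 1) ≤ 2 * n := by nlinarith
  have hW := window_sum_ge hmono hb hlo hh hf (by omega : 1 ≤ n) hcK m
  have hW' : (1013 : ℝ) / 1250 * n * h (m + n) ≤ ∑ q ∈ range n, h (m + q + 1 + n) :=
    hW.trans_eq (sum_congr rfl fun q _ => by rw [show m + n + 1 + q = m + q + 1 + n by ring])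
  have hC := mul_le_mul_of_nonneg_left hW' (by positivity : (0 : ℝ) ≤ V * h (m + n) ^ 2)
  have hx : 0 ≤ (n : ℝ) * h (m + n) ^ 3 := by positivity
  have hD := mul_le_mul_of_nonneg_right hV hx
  nlinarith

/-! ## §2 The argmax step, once for all -/

/-- **THE ARGMAX STEP.**  A dominated profile `L ≥ 0` (`K` ages), `h` a box solution, a finite set of ages `S ⊂ [0, K)`, a value `V ≥ 0` and a potential
`k ↦ k^P·h_{m+k}^Q`: IF for every ordered pair of members `i, n` the argmax hypothesis `i^P·h_{m+i}^Q ≤ n^P·h_{m+n}^Q` yields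
`i·h_{m+i}³∕2 ≤ V·h_{m+n}²·Σ_{q<n} h_{m+q+1+i}`, THEN `Σ_{k∈S} k·L_kh_{m+k}³∕2 ≤ V` — take `n` maximising the potential (`Finset.exists_max_image`), sum the
per-age inequalities against `L ≥ 0`, and bound the block's reads in window `n` by (E100a) `block_window_reads_le`. [folklore] -/
theorem block_load_le_of_argmax (hL : ∀ k, 0 ≤ L k) (hdom : ∀ u, SeqBox γ u → ∑ k ∈ range K, L k * u k ≤ B u) (hh : SeqBox γ h)
    (hf : MemFlow B gIR h) {S : Finset ℕ} (hSK : ∀ k ∈ S, k < K) {V : ℝ} (hV : 0 ≤ V) {P Q : ℕ} (m : ℕ)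
    (hwin : ∀ i ∈ S, ∀ n ∈ S, (i : ℝ) ^ P * h (m + i) ^ Q ≤ (n : ℝ) ^ P * h (m + n) ^ Q →
      (i : ℝ) * h (m + i) ^ 3 / 2 ≤ V * (h (m + n) ^ 2 * ∑ q ∈ range n, h (m + q + 1 + i))) :
    ∑ k ∈ S, (k : ℝ) * (L k * h (m + k) ^ 3 / 2) ≤ V := by
  rcases S.eq_empty_or_nonempty with hSe | hne
  · rw [hSe, sum_empty]; exact hV
  obtain ⟨n, hnS, hmax⟩ := exists_max_image S (fun k => (k : ℝ) ^ P * h (m + k) ^ Q) hne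
  have hw : 0 < h (m + n) := (hh (m + n)).1
  have hreads := block_window_reads_le hL hdom hh hf (S := S) hSK m n
  calc ∑ k ∈ S, (k : ℝ) * (L k * h (m + k) ^ 3 / 2) = ∑ k ∈ S, L k * ((k : ℝ) * h (m + k) ^ 3 / 2) :=
        sum_congr rfl fun k _ => by ring
    _ ≤ ∑ k ∈ S, L k * (V * (h (m + n) ^ 2 * ∑ q ∈ range n, h (m + q + 1 + k))) :=
        sum_le_sum fun k hk => mul_le_mul_of_nonneg_left (hwin k hk n hnS (hmax k hk)) (hL k)
    _ = V * h (m + n) ^ 2 * ∑ k ∈ S, L k * ∑ q ∈ range n, h (m + q + 1 + k) := by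
        rw [mul_sum]; exact sum_congr rfl fun k _ => by ring
    _ ≤ V * h (m + n) ^ 2 * (1 / h (m + n) ^ 2) := mul_le_mul_of_nonneg_left hreads (by positivity)
    _ = V := by field_simp

/-! ## §3 The double octave: `V = 11∕16`, potential `k^5·u^{12}` -/

/-- **A YOUNGER AGE IN THE ARGMAX WINDOW, DOUBLE OCTAVE** (16 boxes of `n∕i ∈ [1, 4]`, `V = 11∕16`, potential `k^5·h^{12}`). [folklore] -/
theorem young_in_old_window_span4 (hmono : ∀ u v : ℕ → ℝ, SeqBox γ u → SeqBox γ v → (∀ j, u j ≤ v j) → B u ≤ B v) (hb : 0 < b)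
    (hlo : ∀ u, SeqBox γ u → b ≤ B u) (hh : SeqBox γ h) (hf : MemFlow B gIR h) {i n : ℕ} (h56 : 56 ≤ i) (hin : i < n)
    (hn2 : n ≤ 4 * i) (m : ℕ) (harg : (i : ℝ) ^ 5 * h (m + i) ^ (2 * (5 + 1)) ≤ (n : ℝ) ^ 5 * h (m + n) ^ (2 * (5 + 1))) :
    (i : ℝ) * h (m + i) ^ 3 / 2 ≤ (11 / 16 : ℝ) * (h (m + n) ^ 2 * ∑ q ∈ range n, h (m + q + 1 + i)) := by
  have hV : (0 : ℝ) < 11 / 16 := by norm_num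
  have hF0 : (1 : ℝ) * i ≤ n := by rw [one_mul]; exact_mod_cast hin.le
  have hn2r : (n : ℝ) ≤ 4 * i := by exact_mod_cast hn2
  rcases le_or_gt (n : ℝ) (547 / 500 * i) with h1 | h1
  · exact young_in_old_window_of_box' hmono hb hlo hh hf h56 hin m hV (by norm_num) hF0 h1 harg
      (ca := 9731 / 10000) (cb := 407 / 500) (sh := 5191 / 5000) (by norm_num)
  rcases le_or_gt (n : ℝ) (1209 / 1000 * i) with h2 | h2
  · exact young_in_old_window_of_box' hmono hb hlo hh hf h56 hin m hV (by norm_num) h1.le h2 harg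
      (ca := 2369 / 2500) (cb := 8261 / 10000) (sh := 10823 / 10000) (by norm_num)
  rcases le_or_gt (n : ℝ) (337 / 250 * i) with h3 | h3
  · exact young_in_old_window_of_box' hmono hb hlo hh hf h56 hin m hV (by norm_num) h2.le h3 harg
      (ca := 4597 / 5000) (cb := 8389 / 10000) (sh := 453 / 400) (by norm_num)
  rcases le_or_gt (n : ℝ) (189 / 125 * i) with h4 | h4
  · exact young_in_old_window_of_box' hmono hb hlo hh hf h56 hin m hV (by norm_num) h3.le h4 harg
      (ca := 8891 / 10000) (cb := 213 / 250) (sh := 297 / 250) (by norm_num)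
  rcases le_or_gt (n : ℝ) (17 / 10 * i) with h5 | h5
  · exact young_in_old_window_of_box' hmono hb hlo hh hf h56 hin m hV (by norm_num) h4.le h5 harg
      (ca := 4289 / 5000) (cb := 8649 / 10000) (sh := 499 / 400) (by norm_num)
  rcases le_or_gt (n : ℝ) (1911 / 1000 * i) with h6 | h6
  · exact young_in_old_window_of_box' hmono hb hlo hh hf h56 hin m hV (by norm_num) h5.le h6 harg
      (ca := 8263 / 10000) (cb := 2193 / 2500) (sh := 6549 / 5000) (by norm_num)
  rcases le_or_gt (n : ℝ) (2141 / 1000 * i) with h7 | h7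
  · exact young_in_old_window_of_box' hmono hb hlo hh hf h56 hin m hV (by norm_num) h6.le h7 harg
      (ca := 7957 / 10000) (cb := 4443 / 5000) (sh := 13733 / 10000) (by norm_num)
  rcases le_or_gt (n : ℝ) (298 / 125 * i) with h8 | h8
  · exact young_in_old_window_of_box' hmono hb hlo hh hf h56 hin m hV (by norm_num) h7.le h8 harg
      (ca := 7667 / 10000) (cb := 2247 / 2500) (sh := 7181 / 5000) (by norm_num)
  rcases le_or_gt (n : ℝ) (1317 / 500 * i) with h9 | h9
  · exact young_in_old_window_of_box' hmono hb hlo hh hf h56 hin m hV (by norm_num) h8.le h9 harg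
      (ca := 37 / 50) (cb := 9077 / 10000) (sh := 3743 / 2500) (by norm_num)
  rcases le_or_gt (n : ℝ) (721 / 250 * i) with h10 | h10
  · exact young_in_old_window_of_box' hmono hb hlo hh hf h56 hin m hV (by norm_num) h9.le h10 harg
      (ca := 7159 / 10000) (cb := 4577 / 5000) (sh := 3887 / 2500) (by norm_num)
  rcases le_or_gt (n : ℝ) (391 / 125 * i) with h11 | h11
  · exact young_in_old_window_of_box' hmono hb hlo hh hf h56 hin m hV (by norm_num) h10.le h11 harg
      (ca := 1389 / 2000) (cb := 9219 / 10000) (sh := 16083 / 10000) (by norm_num)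
  rcases le_or_gt (n : ℝ) (3361 / 1000 * i) with h12 | h12
  · exact young_in_old_window_of_box' hmono hb hlo hh hf h56 hin m hV (by norm_num) h11.le h12 harg
      (ca := 3379 / 5000) (cb := 9273 / 10000) (sh := 4143 / 2500) (by norm_num)
  rcases le_or_gt (n : ℝ) (3579 / 1000 * i) with h13 | h13
  · exact young_in_old_window_of_box' hmono hb hlo hh hf h56 hin m hV (by norm_num) h12.le h13 harg
      (ca := 1649 / 2500) (cb := 9319 / 10000) (sh := 4253 / 2500) (by norm_num)
  rcases le_or_gt (n : ℝ) (3779 / 1000 * i) with h14 | h14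
  · exact young_in_old_window_of_box' hmono hb hlo hh hf h56 hin m hV (by norm_num) h13.le h14 harg
      (ca := 6457 / 10000) (cb := 2339 / 2500) (sh := 17401 / 10000) (by norm_num)
  rcases le_or_gt (n : ℝ) (99 / 25 * i) with h15 | h15
  · exact young_in_old_window_of_box' hmono hb hlo hh hf h56 hin m hV (by norm_num) h14.le h15 harg
      (ca := 3169 / 5000) (cb := 9387 / 10000) (sh := 1109 / 625) (by norm_num)
  · exact young_in_old_window_of_box' hmono hb hlo hh hf h56 hin m hV (by norm_num) h15.le hn2r harg
      (ca := 6313 / 10000) (cb := 9413 / 10000) (sh := 8909 / 5000) (by norm_num)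

/-- **AN OLDER AGE IN THE ARGMAX WINDOW, DOUBLE OCTAVE** (3 boxes of `i∕n ∈ [1, 4]`, `V = 11∕16`, potential `k^5·h^{12}`). [folklore] -/
theorem old_in_young_window_span4 (hmono : ∀ u v : ℕ → ℝ, SeqBox γ u → SeqBox γ v → (∀ j, u j ≤ v j) → B u ≤ B v) (hb : 0 < b)
    (hlo : ∀ u, SeqBox γ u → b ≤ B u) (hh : SeqBox γ h) (hf : MemFlow B gIR h) {i n : ℕ} (h56 : 56 ≤ n) (hni : n < i)
    (hi2 : i ≤ 4 * n) (m : ℕ) (harg : (i : ℝ) ^ 5 * h (m + i) ^ (2 * (5 + 1)) ≤ (n : ℝ) ^ 5 * h (m + n) ^ (2 * (5 + 1))) :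
    (i : ℝ) * h (m + i) ^ 3 / 2 ≤ (11 / 16 : ℝ) * (h (m + n) ^ 2 * ∑ q ∈ range n, h (m + q + 1 + i)) := by
  have hV : (0 : ℝ) < 11 / 16 := by norm_num
  have hF0 : (1 : ℝ) * n ≤ i := by rw [one_mul]; exact_mod_cast hni.le
  have hi2r : (i : ℝ) ≤ 4 * n := by exact_mod_cast hi2
  rcases le_or_gt (i : ℝ) (393 / 200 * n) with h1 | h1
  · exact old_in_young_window_of_box' hmono hb hlo hh hf h56 hni m hV (by norm_num) hF0 h1 harg
      (cb := 407 / 500) (sl := 1787 / 2000) (by norm_num)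
  rcases le_or_gt (i : ℝ) (423 / 125 * n) with h2 | h2
  · exact old_in_young_window_of_box' hmono hb hlo hh hf h56 hni m hV (by norm_num) h1.le h2 harg
      (cb := 557 / 625) (sl := 8161 / 10000) (by norm_num)
  · exact old_in_young_window_of_box' hmono hb hlo hh hf h56 hni m hV (by norm_num) h2.le hi2r harg
      (cb := 9323 / 10000) (sl := 7937 / 10000) (by norm_num)

/-- **THE DOUBLE-OCTAVE CAP.**  `B` an isotone memory with floor `b > 0` dominating the profile `L ≥ 0` (`K` ages), `h` a box solution; ANY finite set `S` of
ages inside `[lo, hi]` with `56 ≤ lo`, `hi ≤ 4·lo`, `hi < K`: `Σ_{k∈S} k·L_kh_{m+k}³∕2 ≤ 11∕16` at every pin (`block_load_le_of_argmax` with the potential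
`k^5·h_{m+k}^{12}`; younger ∕ own ∕ older by `young_in_old_window_span4` ∕ `own_window_le'` ∕ `old_in_young_window_span4`). [folklore] -/
theorem old_block_load_le_span4 (hmono : ∀ u v : ℕ → ℝ, SeqBox γ u → SeqBox γ v → (∀ j, u j ≤ v j) → B u ≤ B v)
    (hL : ∀ k, 0 ≤ L k) (hb : 0 < b) (hlo : ∀ u, SeqBox γ u → b ≤ B u) (hdom : ∀ u, SeqBox γ u → ∑ k ∈ range K, L k * u k ≤ B u)
    (hh : SeqBox γ h) (hf : MemFlow B gIR h) {S : Finset ℕ} {lo hi : ℕ} (h56 : 56 ≤ lo) (hhi : hi ≤ 4 * lo) (hhiK : hi < K)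
    (hS : ∀ k ∈ S, lo ≤ k ∧ k ≤ hi) (m : ℕ) : ∑ k ∈ S, (k : ℝ) * (L k * h (m + k) ^ 3 / 2) ≤ 11 / 16 := by
  refine block_load_le_of_argmax hL hdom hh hf (fun k hk => lt_of_le_of_lt (hS k hk).2 hhiK) (by norm_num) (P := 5) (Q := 2 * (5 + 1)) m
    fun i hi n hn harg => ?_
  obtain ⟨hi1, hi2⟩ := hS i hi
  obtain ⟨hn1, hn2⟩ := hS n hn
  rcases lt_trichotomy i n with hlt | heq | hgt
  · exact young_in_old_window_span4 hmono hb hlo hh hf (by omega) hlt (by omega) m harg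
  · subst heq; exact own_window_le' hmono hb hlo hh hf (by omega) m (by norm_num)
  · exact old_in_young_window_span4 hmono hb hlo hh hf (by omega) hgt (by omega) m harg

end Summit.QuantumFields.BalabanUV.Beta.EriceRemainderEnclosureHistoryAutonomyComparisonAgeCompositionOldBlockCapWide
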